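import Mathlib
import Literature.Computability.AlgebraicComplexity.PIProof
import Summits.ValiantsHypothesis.ValiantsHypothesis.Theorems.ProofCarryingSymmetryRestorationQPACFormula
import Summits.ValiantsHypothesis.ValiantsHypothesis.Theorems.ProofCarryingSymmetryRestorationQPACStabilityPF
import Summits.ValiantsHypothesis.ValiantsHypothesis.Theorems.ProofCarryingSymmetryRestorationQPACBudgetCalculus

/-!
# Crux `RestorationQP` (stmt-ValiantsHypothesis-10343), line `registered`: the AC-equivalence
calculus under stub S2″ `stub_proofsToACEquiv`

After the lead's second reshape the stability pair is typed over UNFOLDINGS: S2″ asks for a circuit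
`C'` all of whose invariance identities hold as `P_f(ℂ)`-inter-derivability of `(C' ∘ σ)•` and
`C'•` with no instance of A6–A10 — equivalently (`ACStability.acEq_iff_pfProvable`) as
`ACEq (C' ∘ σ)• C'•`, equality modulo associativity and commutativity.  This file transports the
rungs of `…RestorationQPACBudgetCalculus` (the `P_c`-budget form) to this presentation-free form:

* `acEq_unfold_rename_smul_mul / _one_smul / _of_mclosure_eq_top` — for a fixed circuit the `g`
  with `ACEq (C ∘ g)• C•` form a submonoid of any monoid acting on the variables (products by
  `ACEq.rename` + `rename_rename'`; generators suffice by `Submonoid.closure_le`);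
* `proofsToACEquiv_aux_pf_mul`, `proofsToACEquiv_aux_pf_of_adjacent` — the same in the literal
  `(pfSystem ℂ _).Provable … ⊤ ACB` phrasing of S2″ (products; the `n` adjacent transpositions of
  `Fin (n + 1)` give all of `S_{n+1}`, `Equiv.Perm.mclosure_swap_castSucc_succ`);
* `proofsToACEquiv_allPerm`, `proofsToACEquiv_fixed_n` — S2″ holds QUALITATIVELY and for each
  FIXED `n` (`c = n + 2`): the orbit average `(1/n!) Σ_σ C ∘ σ` has `P_c`-proofs of its invariance
  identities within the AC budget (`proofsToACInvariance_allPerm`), hence (AC-soundness,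
  `ACStability.pfProvable_unfold_of_hasPCProof`) AC-inter-derivable unfoldings.  Only the
  uniformity of `c` in `n` is at stake in S2″.
-/

-- single-problem summit: `Summit.ValiantsHypothesis.ValiantsHypothesis.…` is the namespace by design (D-0017)
set_option linter.dupNamespace false

namespace Summit.ValiantsHypothesis.ValiantsHypothesis.Theorems

open MvPolynomial Literature.Computability.AlgebraicComplexity ACStability

universe u v

/-! ### For a fixed circuit, the `g` with `(C ∘ g)• ≡_AC C•` form a submonoid -/

section Monoid

variable {𝔽 : Type u} [Zero 𝔽] {X : Type v} {M : Type*} [Monoid M] [MulAction M X]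

/-- **Products.** `(C ∘ h)• ≡_AC C•` renamed along `g` reads `(C ∘ g h)• ≡_AC (C ∘ g)•`
(`ACEq.rename`); chain with `(C ∘ g)• ≡_AC C•`. [folklore] -/
theorem acEq_unfold_rename_smul_mul (C : PICircuit 𝔽 X) {g h : M}
    (hg : ACEq (C.rename fun x : X => g • x).unfold C.unfold)
    (hh : ACEq (C.rename fun x : X => h • x).unfold C.unfold) :
    ACEq (C.rename fun x : X => (g * h) • x).unfold C.unfold := by
  rw [PICircuit.unfold_rename] at hg hh ⊢
  have hh' := hh.rename fun x : X => g • x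
  rw [rename_rename'] at hh'
  have hcomp : ((fun x : X => g • x) ∘ fun x : X => h • x) = fun x : X => (g * h) • x :=
    funext fun x => (mul_smul g h x).symm
  rw [hcomp] at hh'
  exact hh'.trans hg

/-- **Unit.** `(C ∘ 1)• = C•`. [folklore] -/
theorem acEq_unfold_rename_one_smul (C : PICircuit 𝔽 X) :
    ACEq (C.rename fun x : X => (1 : M) • x).unfold C.unfold := by
  have h1 : (fun x : X => (1 : M) • x) = id := funext fun x => one_smul M x
  rw [h1, piCircuit_rename_id]
  exact .refl _

/-- **Generators suffice** for AC-invariance of the unfolding. [folklore] -/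
theorem acEq_unfold_rename_smul_of_mclosure_eq_top (S : Set M) (hS : Submonoid.closure S = ⊤)
    (C : PICircuit 𝔽 X) (h : ∀ g ∈ S, ACEq (C.rename fun x : X => g • x).unfold C.unfold) (m : M) :
    ACEq (C.rename fun x : X => m • x).unfold C.unfold := by
  let H : Submonoid M :=
    { carrier := {m | ACEq (C.rename fun x : X => m • x).unfold C.unfold}
      one_mem' := acEq_unfold_rename_one_smul C
      mul_mem' := fun ha hb => acEq_unfold_rename_smul_mul C ha hb }
  have hle : Submonoid.closure S ≤ H := Submonoid.closure_le.2 fun g hg => h g hg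
  exact hle (hS ▸ Submonoid.mem_top m)

end Monoid

/-! ### The same in the literal phrasing of S2″ -/

/-- **Products**, S2″ phrasing: A6–A10-free `P_f` proofs of `(C ∘ σ)• = C•` and `(C ∘ τ)• = C•`
give one of `(C ∘ σ τ)• = C•`. [folklore] -/
theorem proofsToACEquiv_aux_pf_mul : ∀ (n : ℕ) (C : PICircuit ℂ (Fin n × Fin n)) (σ τ : Equiv.Perm (Fin n)), (pfSystem ℂ (Fin n × Fin n)).Provable (C.rename fun x : Fin n × Fin n => σ • x).unfold C.unfold ⊤ (fun s => if s = PIAxiom.A6 ∨ s = PIAxiom.A7 ∨ s = PIAxiom.A8 ∨ s = PIAxiom.A9 ∨ s = PIAxiom.A10 then 0 else ⊤) → (pfSystem ℂ (Fin n × Fin n)).Provable (C.rename fun x : Fin n × Fin n => τ • x).unfold C.unfold ⊤ (fun s => if s = PIAxiom.A6 ∨ s = PIAxiom.A7 ∨ s = PIAxiom.A8 ∨ s = PIAxiom.A9 ∨ s = PIAxiom.A10 then 0 else ⊤) → (pfSystem ℂ (Fin n × Fin n)).Provable (C.rename fun x : Fin n × Fin n => (σ * τ) • x).unfold C.unfold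 ⊤ (fun s => if s = PIAxiom.A6 ∨ s = PIAxiom.A7 ∨ s = PIAxiom.A8 ∨ s = PIAxiom.A9 ∨ s = PIAxiom.A10 then 0 else ⊤) :=
  fun _ C _ _ hσ hτ => pfProvable_of_acEq (acEq_unfold_rename_smul_mul C
    (acEq_of_pfProvable (fun _ hs => if_pos hs) hσ) (acEq_of_pfProvable (fun _ hs => if_pos hs) hτ))

/-- **Adjacent transpositions suffice**, S2″ phrasing: A6–A10-free `P_f` proofs of
`(C ∘ (i i+1))• = C•` for the `n` adjacent transpositions of `Fin (n + 1)` give such proofs of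
`(C ∘ σ)• = C•` for every `σ ∈ S_{n+1}`. [folklore] -/
theorem proofsToACEquiv_aux_pf_of_adjacent : ∀ (n : ℕ) (C : PICircuit ℂ (Fin (n + 1) × Fin (n + 1))), (∀ i : Fin n, (pfSystem ℂ (Fin (n + 1) × Fin (n + 1))).Provable (C.rename fun x : Fin (n + 1) × Fin (n + 1) => (Equiv.swap i.castSucc i.succ) • x).unfold C.unfold ⊤ (fun s => if s = PIAxiom.A6 ∨ s = PIAxiom.A7 ∨ s = PIAxiom.A8 ∨ s = PIAxiom.A9 ∨ s = PIAxiom.A10 then 0 else ⊤)) → ∀ σ : Equiv.Perm (Fin (n + 1)), (pfSystem ℂ (Fin (n + 1) × Fin (n + 1))).Provable (C.rename fun x : Fin (n + 1) × Fin (n + 1) => σ • x).unfold C.unfold ⊤ (fun s => if s = PIAxiom.A6 ∨ s = PIAxiom.A7 ∨ s = PIAxiom.A8 ∨ s = PIAxiom.A9 ∨ s = PIAxiom.A10 then 0 else ⊤) := by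
  intro n C h σ
  refine pfProvable_of_acEq (acEq_unfold_rename_smul_of_mclosure_eq_top _
    (Equiv.Perm.mclosure_swap_castSucc_succ n) C ?_ σ)
  rintro _ ⟨i, rfl⟩
  exact acEq_of_pfProvable (fun _ hs => if_pos hs) (h i)

/-! ### S2″ holds qualitatively, and for each fixed `n` -/

/-- **S2″ without the size bound.** If `Ĉ` is `S_n`-invariant, the orbit average
`C' = (1/n!) Σ_σ C ∘ σ` computes `Ĉ`, has size `≤ n! (|C| + 1) + 3`, and for every `σ` the
unfoldings `(C' ∘ σ)•`, `C'•` are inter-derivable in `P_f(ℂ)` without A6–A10 (its invariance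
identities even have such `P_c` proofs, `proofsToACInvariance_allPerm`; AC-soundness). [folklore] -/
theorem proofsToACEquiv_allPerm : ∀ (n : ℕ) (C : PICircuit ℂ (Fin n × Fin n)),
    (∀ σ : Equiv.Perm (Fin n),
      MvPolynomial.rename (fun x : Fin n × Fin n => σ • x) C.eval = C.eval) →
    ∃ C' : PICircuit ℂ (Fin n × Fin n), C'.eval = C.eval ∧
      C'.size ≤ n.factorial * (C.size + 1) + 3 ∧
      ∀ σ : Equiv.Perm (Fin n), (pfSystem ℂ (Fin n × Fin n)).Provable
        (C'.rename fun x : Fin n × Fin n => σ • x).unfold C'.unfold ⊤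
        (fun s => if s = PIAxiom.A6 ∨ s = PIAxiom.A7 ∨ s = PIAxiom.A8 ∨ s = PIAxiom.A9 ∨
          s = PIAxiom.A10 then 0 else ⊤) := by
  intro n C hC
  obtain ⟨C', hev, hsize, hpf⟩ := proofsToACInvariance_allPerm n C hC
  exact ⟨C', hev, hsize, fun σ => pfProvable_unfold_of_hasPCProof (fun _ hs => if_pos hs) (hpf σ)⟩

/-- **The `∀ n, ∃ c` form of S2″ holds** (`c = n + 2`): for each FIXED `n`, size-`t` proofs of all
invariance identities of `C` (indeed mere `S_n`-invariance of `Ĉ`, which they give by soundness)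
yield `C'` computing `Ĉ` of size `≤ (|C| + t + n + 2)^(n+2)` with AC-inter-derivable unfoldings
`(C' ∘ σ)•`, `C'•` for every `σ`.  The registered stub S2″ asks for `c` uniform in `n`. [folklore] -/
theorem proofsToACEquiv_fixed_n : ∀ n : ℕ, ∃ c : ℕ, ∀ (t : ℕ) (C : PICircuit ℂ (Fin n × Fin n)), (∀ σ : Equiv.Perm (Fin n), HasPCProofOfSize (C.rename fun x : Fin n × Fin n => σ • x) C t) → ∃ C' : PICircuit ℂ (Fin n × Fin n), C'.eval = C.eval ∧ C'.size ≤ (C.size + t + n + 2) ^ c ∧ ∀ σ : Equiv.Perm (Fin n), (pfSystem ℂ (Fin n × Fin n)).Provable (C'.rename fun x : Fin n × Fin n => σ • x).unfold C'.unfold ⊤ (fun s => if s = PIAxiom.A6 ∨ s = PIAxiom.A7 ∨ s = PIAxiom.A8 ∨ s = PIAxiom.A9 ∨ s = PIAxiom.A10 then 0 else ⊤) := by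
  intro n
  obtain ⟨c, hc⟩ := proofsToACInvariance_fixed_n n
  refine ⟨c, fun t C h => ?_⟩
  obtain ⟨C', hev, hsize, hpf⟩ := hc t C h
  exact ⟨C', hev, hsize, fun σ => pfProvable_unfold_of_hasPCProof (fun _ hs => if_pos hs) (hpf σ)⟩

end Summit.ValiantsHypothesis.ValiantsHypothesis.Theorems
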